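import Literature.MathematicalPhysics.QuantumFieldTheory.Balaban1983to89.BlockAveragingExpMeanLog
import Mathlib.Analysis.SpecialFunctions.Exponential
import HarnessLib

/-!
# Route `UnitScaleTilt`, crux K1 «MinimiserStabilityRegPr» (stmt-QuantumFields-19200), route-R [RP] curved ∕ (α) (AVG-SYM) operator junction —
# THE CURVED N6, THIRD BRICK: THE DERIVATIVE OF THE EXACT COVARIANCE (0.6) OF `exp[mean log]` —
# `D eml(W₀)[i ↦ ξ·W₀,i − W₀,i·ξ] = ξ·eml(W₀) − eml(W₀)·ξ` at every point of differentiability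

Cell `ym3-torus`, width seat `ym-ust-20520-w2` (g2); sequel of ✓ p602235 `…CovLinAvgStructureStep`, ⧗ p602989 `…CovLinAvgPureGauge` and the LOCATED notes (19200 evidence #44,
`CURVED-N6-LOCATED-w2g2.md`).  WHY.  On a pure gauge the tree's main-term linearisation `covLinAvg` ((124)) leaves the commutator mean `|I|⁻¹Σ_i (ξ − W⁰_iξW⁰_i*)`
(`Prop7CovLinAvgPureGauge.covLinAvg_pureGauge`); the TRUE one-step derivative of the (0.4) average (★p1 g4's `Prop7AvgTrueLinearisation`:
`D eml(W₀)[i ↦ Λ_i·W₀,i]·κ₀* + κ₀·Λ_S·κ₀*`) absorbs it EXACTLY, because `eml{uW_iu⁻¹} = u·eml{W_i}·u⁻¹` ([Balaban1987RG1] (0.6), tree `ExpMeanLog.eml_conj`) differentiated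
along `u = e^{tξ}` says `D eml(W₀)` maps the commutator direction `[ξ, W₀]` to the commutator `[ξ, eml W₀]`.  This file proves that derivative identity, for `eml` on any
complete normed `ℂ`-algebra — the letter that makes the curved (1.20) ∕ `iterLambda_grad` EXACT for the true `Q(U₀)`.  THEOREMS ONLY (0 `def`, 0 `sorry`);
`--supports stmt-QuantumFields-19200`, count-neutral.  YM₃ on T³ is a ladder rung (R3), not the Clay problem; nothing here claims the curved N6, S2, P, the crux or the gap.

WHAT IS PROVED (ns `…Theorems.Prop7EmlFDerivConj`; `𝔸` complete normed `ℂ`-algebra, `exp = NormedSpace.exp`).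
* §1 `exp_smul_mul_exp_smul_neg` (`e^{tξ}e^{−tξ} = 1`), ★ `hasDerivAt_conj_exp` — `t ↦ e^{tξ}·W·e^{−tξ}` has derivative `ξW − Wξ` at `t = 0`; `hasDerivAt_conj_exp_pi` (families).
* §2 ★★ `fderiv_eml_comm` — for `W₀ : ι → 𝔸` with `eml` differentiable at `W₀` (e.g. `‖W₀ − 1‖ < 1/3`, `ExpMeanLog.analyticAt_eml` ∕ `isAnalyticMean_eml`) and any `ξ`:
  `fderiv ℂ eml W₀ (fun i => ξ * W₀ i − W₀ i * ξ) = ξ * eml W₀ − eml W₀ * ξ`; `fderiv_eml_comm_of_norm_sub_one_lt` (the polydisc `‖W₀,i − 1‖ < 1`, `ExpMeanLog.differentiableAt_eml`).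
HONEST SCOPE.  One calculus identity ([folklore] ∕ (0.6) differentiated); the assembly into the true `Q(U₀)` on pure gauges is the next brick.

References: T. Bałaban, CMP 109 (1987) 249–301 [Balaban1987RG1] ((0.4)–(0.6) p.253); CMP 98 (1985) 17–51 [Balaban1985Averaging] ((124) p.36); CMP 95 (1984) 17–40
[Balaban1984PropagatorsI] ((1.20) p.20).
-/

noncomputable section

namespace Summit.QuantumFields.YangMills.Theorems.Prop7EmlFDerivConj

open NormedSpace
open Literature.MathematicalPhysics.QuantumFieldTheory.Balaban1983to89
open ExpMeanLog

variable {𝔸 : Type*} [NormedRing 𝔸] [NormedAlgebra ℂ 𝔸] [CompleteSpace 𝔸]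

/-! ## §1 Conjugation by a one-parameter group -/

/-- `e^{tξ}·e^{t(−ξ)} = 1`. [folklore] -/
theorem exp_smul_mul_exp_smul_neg (ξ : 𝔸) (t : ℂ) : exp (t • ξ) * exp (t • (-ξ)) = 1 := by
  letI : NormedAlgebra ℚ 𝔸 := NormedAlgebra.restrictScalars ℚ ℂ 𝔸
  rw [smul_neg, ← exp_add_of_commute (Commute.neg_right (Commute.refl (t • ξ))), add_neg_cancel, exp_zero]

/-- `e^{t(−ξ)}·e^{tξ} = 1`. [folklore] -/
theorem exp_smul_neg_mul_exp_smul (ξ : 𝔸) (t : ℂ) : exp (t • (-ξ)) * exp (t • ξ) = 1 := by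
  letI : NormedAlgebra ℚ 𝔸 := NormedAlgebra.restrictScalars ℚ ℂ 𝔸
  rw [smul_neg, ← exp_add_of_commute (Commute.neg_left (Commute.refl (t • ξ))), neg_add_cancel, exp_zero]

/-- ★ **THE DERIVATIVE OF CONJUGATION**: `t ↦ e^{tξ}·W·e^{−tξ}` has derivative `ξW − Wξ` at `t = 0`. [folklore] -/
theorem hasDerivAt_conj_exp (W ξ : 𝔸) :
    HasDerivAt (fun t : ℂ => exp (t • ξ) * W * exp (t • (-ξ))) (ξ * W - W * ξ) 0 := by
  have h1 : HasDerivAt (fun t : ℂ => exp (t • ξ)) ξ 0 := by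
    have h := hasDerivAt_exp_smul_const' (𝕂 := ℂ) ξ (0 : ℂ)
    rwa [zero_smul, exp_zero, mul_one] at h
  have h2 : HasDerivAt (fun t : ℂ => exp (t • ξ) * W) (ξ * W) 0 := h1.mul_const W
  have h3 : HasDerivAt (fun t : ℂ => exp (t • (-ξ))) (-ξ) 0 := by
    have h := hasDerivAt_exp_smul_const' (𝕂 := ℂ) (-ξ) (0 : ℂ)
    rwa [zero_smul, exp_zero, mul_one] at h
  have h4 := h2.mul h3
  simp only [zero_smul, exp_zero, mul_one, one_mul] at h4
  refine (h4.congr_deriv ?_)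
  noncomm_ring

/-- The same for a family, componentwise. [folklore] -/
theorem hasDerivAt_conj_exp_pi {ι : Type*} [Fintype ι] (W : ι → 𝔸) (ξ : 𝔸) :
    HasDerivAt (fun t : ℂ => fun i => exp (t • ξ) * W i * exp (t • (-ξ))) (fun i => ξ * W i - W i * ξ) 0 :=
  hasDerivAt_pi.2 fun i => hasDerivAt_conj_exp (W i) ξ

/-! ## §2 ★★ The derivative of the exact covariance of `exp[mean log]` -/

/-- ★★ **`D eml(W₀)[[ξ, W₀]] = [ξ, eml W₀]`**: wherever `eml` is `ℂ`-differentiable, its Fréchet derivative maps the commutator direction `i ↦ ξW₀,i − W₀,iξ` to the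
commutator `ξ·eml W₀ − eml W₀·ξ` — the derivative at `t = 0` of the exact covariance `eml{e^{tξ}W_ie^{−tξ}} = e^{tξ}·eml{W_i}·e^{−tξ}` ((0.6), `ExpMeanLog.eml_conj`).
[cite: Balaban1987RG1, (0.6) p.253] -/
theorem fderiv_eml_comm {ι : Type*} [Fintype ι] (W₀ : ι → 𝔸) (hd : DifferentiableAt ℂ (eml : (ι → 𝔸) → 𝔸) W₀) (ξ : 𝔸) :
    fderiv ℂ (eml : (ι → 𝔸) → 𝔸) W₀ (fun i => ξ * W₀ i - W₀ i * ξ) = ξ * eml W₀ - eml W₀ * ξ := by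
  -- the conjugated family and its image under `eml`
  have hγ := hasDerivAt_conj_exp_pi W₀ ξ
  have hγ0 : W₀ = (fun t : ℂ => fun i => exp (t • ξ) * W₀ i * exp (t • (-ξ))) 0 := by
    funext i; simp
  have hcomp := hd.hasFDerivAt.comp_hasDerivAt_of_eq (0 : ℂ) hγ hγ0
  have heq : ((eml : (ι → 𝔸) → 𝔸) ∘ fun t : ℂ => fun i => exp (t • ξ) * W₀ i * exp (t • (-ξ)))
      = fun t : ℂ => exp (t • ξ) * eml W₀ * exp (t • (-ξ)) := by
    funext t
    simp only [Function.comp_apply]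
    exact eml_conj (exp_smul_mul_exp_smul_neg ξ t) (exp_smul_neg_mul_exp_smul ξ t) W₀
  rw [heq] at hcomp
  exact hcomp.unique (hasDerivAt_conj_exp (eml W₀) ξ)

/-- The polydisc version: `‖W₀,i − 1‖ < 1` for every `i` suffices (`ExpMeanLog.differentiableAt_eml`; the small-field families of (0.4) are inside).
[cite: Balaban1987RG1, (0.6) p.253] -/
theorem fderiv_eml_comm_of_norm_sub_one_lt {ι : Type*} [Fintype ι] (W₀ : ι → 𝔸) (hW : ∀ i, ‖W₀ i - 1‖ < 1) (ξ : 𝔸) :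
    fderiv ℂ (eml : (ι → 𝔸) → 𝔸) W₀ (fun i => ξ * W₀ i - W₀ i * ξ) = ξ * eml W₀ - eml W₀ * ξ :=
  fderiv_eml_comm W₀ (differentiableAt_eml hW) ξ

end Summit.QuantumFields.YangMills.Theorems.Prop7EmlFDerivConj

end
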